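import Mathlib
import HarnessLib
import Summits.NavierStokesRegularity.NavierStokesRegularity.Theses.IsobarTomography
import Summits.NavierStokesRegularity.NavierStokesRegularity.Theorems.IsobarTomographyBlobRiccatiClosureApexZoom

/-!
# Crux `IsobarTomography.BlobRiccatiClosure` (stmt-NavierStokesRegularity-11740), line
# `type-i-apex-liouville` — the glue: the crux modulo `NoTypeII` and the apex anti-blob residual

Helper file (theorems only) `--supports` the item. With stub B (`stub_apexZoom`, the extremal-apex
zoom) LANDED, the line's composition is kernel-checked here in its discharged form:

* `blobTypeIExclusion_of_apexAntiBlob` — the Type-I form of the crux follows from the residual C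
  alone: if every apex of a Type-I ancient mild field is anti-blob, then no MAXIMAL Type-I
  Leray–Hopf solution from a rapidly decaying datum satisfies the blob hypothesis (B produces an
  apex carrying the blob mark; C forbids it).
* `stub_cruxOfApexAntiBlob` (registered glue) — `NoTypeII → ApexAntiBlob → BlobRiccatiClosure`:
  the crux BY NAME from the route's own item `NoTypeII` (stmt-NavierStokesRegularity-0056) and the
  residual C (`stub_apexAntiBlob` of the skeleton, open-problem class).
* `apexAntiBlob_of_typeIAncientLiouville` — calibration: the residual C is implied by the
  programme's Type-I Liouville statement (the signature of stmt-NavierStokesRegularity-4050,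
  `ExtremalTypeIConstant.TypeIAncientLiouville`, taken here as an explicit hypothesis spelled out
  in the tree's vocabulary — no new definition), hence `NoTypeII ∧ TypeIAncientLiouville ⇒ K1`
  (`blobRiccatiClosure_of_noTypeII_of_typeIAncientLiouville`).

* `apexAntiBlob_iff_signs` — the κ-free form of C: at every apex `0 ≤ Δq`, `D²q[ω,ω] ≤ 0`, and
  `< 0` when `Δq = 0` (elementary: `forall_pos_lt_mul_iff`).

So after this file the honest open content of the crux is exactly: A = stmt-0056 and
C = "Type-I apexes are anti-blob" (≤ stmt-4050). References: the line card
`Cruxes/BlobRiccatiClosure/Lines/type-i-apex-liouville.md`; KNSS, Acta Math. 203 (2009)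
[KochNadirashviliSereginSverak2009] for the habitat.
-/

noncomputable section

open Set Filter Topology Function

-- the summit and its single sub-problem share the name (CONVENTIONS §1), as in every Theorems file
set_option linter.dupNamespace false

namespace Summit.NavierStokesRegularity.NavierStokesRegularity.Theorems.BlobRiccatiClosure.TypeIApexLiouville

open Literature.Analysis Literature.Analysis.FluidPDE
open Summit.NavierStokesRegularity.NavierStokesRegularity.Theses

/-- **The Type-I form of the crux from the residual C.** If at every apex `(σ, 0)` of every Type-I
ancient mild field with classical pressure the blob inequality fails (for the given `κ > 0`), then
no maximal classical solution on `[0, T)`, Leray–Hopf from a rapidly decaying datum and blowing up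
at the Type-I rate, satisfies the blob hypothesis with this `κ` — by the extremal-apex zoom
`stub_apexZoom`. [folklore] -/
theorem not_blob_of_apexAntiBlob {κ : ℝ} (hκ : 0 < κ)
    (hC : ∀ (C : ℝ) (W : ℝ → EuclideanSpace ℝ (Fin 3) → EuclideanSpace ℝ (Fin 3))
      (q : ℝ → EuclideanSpace ℝ (Fin 3) → ℝ) (σ : ℝ),
      IsTypeIAncientMild C W → IsClassicalNSSolutionOn (Iio 0) 1 0 W q → σ < 0 →
      ‖curl (W σ) 0‖ = 1 →
      (∀ s < 0, ∀ y : EuclideanSpace ℝ (Fin 3), (-s) * ‖curl (W s) y‖ ≤ -σ) →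
      iteratedFDeriv ℝ 2 (q σ) 0 ![curl (W σ) 0, curl (W σ) 0] <
        κ * ‖curl (W σ) 0‖ ^ 2 * Laplacian.laplacian (q σ) 0)
    {ν T : ℝ} (hν : 0 < ν) (hT : 0 < T)
    {u : ℝ → EuclideanSpace ℝ (Fin 3) → EuclideanSpace ℝ (Fin 3)}
    {p : ℝ → EuclideanSpace ℝ (Fin 3) → ℝ} (hmax : IsMaximalSmoothSolution ν 0 u p T)
    (hLH : IsLerayHopfOn T ν 0 (u 0) u) (hdec : HasRapidSpatialDecay (u 0))
    (hI : IsTypeIBlowup u T) (Ω : ℝ → ℝ) {t₀ : ℝ} (ht₀ : t₀ ∈ Ico 0 T) :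
    ¬ ∀ t ∈ Ico t₀ T, (∃ x : EuclideanSpace ℝ (Fin 3), Ω t < ‖curl (u t) x‖) ∧
        ∀ x : EuclideanSpace ℝ (Fin 3), Ω t < ‖curl (u t) x‖ →
          κ * ‖curl (u t) x‖ ^ 2 * Laplacian.laplacian (p t) x ≤
            iteratedFDeriv ℝ 2 (p t) x ![curl (u t) x, curl (u t) x] := by
  intro hH
  obtain ⟨C, W, q, σ, hW, hWq, hσ, hω1, hapex, hblobW⟩ :=
    stub_apexZoom ν T hν hT u p hmax hLH hdec hI κ Ω t₀ hκ ht₀ hH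
  exact absurd hblobW (not_le.2 (hC C W q σ hW hWq hσ hω1 hapex))

/-- **Registered glue `stub_cruxOfApexAntiBlob` (line `type-i-apex-liouville`): the crux
`IsobarTomography.BlobRiccatiClosure` BY NAME from the route's item `NoTypeII`
(stmt-NavierStokesRegularity-0056) and the apex anti-blob residual C (`stub_apexAntiBlob`,
open-problem class, ≤ stmt-NavierStokesRegularity-4050).** Not extendable ⇒ maximal ⇒ Type I
(`NoTypeII`) ⇒ an apex profile carrying the blob mark (landed `stub_apexZoom`) ⇒ contradiction
with C. [folklore] -/
theorem stub_cruxOfApexAntiBlob : IsobarTomography.NoTypeII → (∀ κ : ℝ, 0 < κ → ∀ (C : ℝ) (W : ℝ → EuclideanSpace ℝ (Fin 3) → EuclideanSpace ℝ (Fin 3)) (q : ℝ → EuclideanSpace ℝ (Fin 3) → ℝ) (σ : ℝ), IsTypeIAncientMild C W → IsClassicalNSSolutionOn (Iio 0) 1 0 W q → σ < 0 → ‖curl (W σ) 0‖ = 1 → (∀ s < 0, ∀ y : EuclideanSpace ℝ (Fin 3), (-s) * ‖curl (W s) y‖ ≤ -σ) → iteratedFDeriv ℝ 2 (q σ) 0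 ![curl (W σ) 0, curl (W σ) 0] < κ * ‖curl (W σ) 0‖ ^ 2 * Laplacian.laplacian (q σ) 0) → IsobarTomography.BlobRiccatiClosure := by
  intro hII hC ν T hν hT u p hcl hLH hdec hblob
  by_contra hext
  have hmax : IsMaximalSmoothSolution ν 0 u p T := ⟨hcl, hext⟩
  have hI : IsTypeIBlowup u T := hII ν T hν hT u p hmax hLH hdec
  obtain ⟨κ, hκ, Ω, t₀, ht₀, hH⟩ := hblob
  exact not_blob_of_apexAntiBlob hκ (hC κ hκ) hν hT hmax hLH hdec hI Ω ht₀ hH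

/-- **Calibration: the residual C is implied by the programme's Type-I Liouville statement** (the
signature of stmt-NavierStokesRegularity-4050 `ExtremalTypeIConstant.TypeIAncientLiouville`,
spelled out: every Type-I ancient mild field in the KNSS gauge vanishes identically). If every such
field vanishes, no apex exists (`‖curl W(σ, 0)‖ = 1` is impossible for `W(σ, ·) ≡ 0`), so C holds
vacuously. [folklore] -/
theorem apexAntiBlob_of_typeIAncientLiouville
    (hL : ∀ (C : ℝ) (u : ℝ → EuclideanSpace ℝ (Fin 3) → EuclideanSpace ℝ (Fin 3)),
      ContDiffOn ℝ (⊤ : ℕ∞) (Function.uncurry u) (Set.Iio 0 ×ˢ Set.univ) ∧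
      (∀ t < 0, Literature.Analysis.FluidPDE.VectorCalculus.IsDivFree (u t)) ∧
      (∀ s t : ℝ, s < t → t < 0 → ∀ x, u t x =
        Literature.Analysis.FluidPDE.heatFlow (u s) (t - s) x -
          ∫ τ in Set.Ioo s t, ∫ y,
            Literature.Analysis.FluidPDE.oseenKernel (t - τ) (x - y) (u τ y) (u τ y)) ∧
      Literature.Analysis.FluidPDE.HasTypeITimeDecay C u → ∀ t < 0, ∀ x, u t x = 0) :
    ∀ κ : ℝ, 0 < κ → ∀ (C : ℝ) (W : ℝ → EuclideanSpace ℝ (Fin 3) → EuclideanSpace ℝ (Fin 3))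
      (q : ℝ → EuclideanSpace ℝ (Fin 3) → ℝ) (σ : ℝ),
      IsTypeIAncientMild C W → IsClassicalNSSolutionOn (Iio 0) 1 0 W q → σ < 0 →
      ‖curl (W σ) 0‖ = 1 →
      (∀ s < 0, ∀ y : EuclideanSpace ℝ (Fin 3), (-s) * ‖curl (W s) y‖ ≤ -σ) →
      iteratedFDeriv ℝ 2 (q σ) 0 ![curl (W σ) 0, curl (W σ) 0] <
        κ * ‖curl (W σ) 0‖ ^ 2 * Laplacian.laplacian (q σ) 0 := by
  intro κ _hκ C W q σ hW _hWq hσ hω1 _hapex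
  exfalso
  have hzero : ∀ x, W σ x = 0 := hL C W (isTypeIAncientMild_iff.1 hW) σ hσ
  have hWσ : W σ = fun _ => (0 : EuclideanSpace ℝ (Fin 3)) := funext hzero
  have : ‖curl (W σ) 0‖ = 0 := by rw [hWσ, curl_fun_zero, norm_zero]
  rw [this] at hω1
  exact zero_ne_one hω1

/-- **`NoTypeII ∧ TypeIAncientLiouville ⇒ BlobRiccatiClosure`**: the crux by name from the route's
item stmt-0056 and the signature of the programme's Type-I Liouville node stmt-4050 (both taken as
hypotheses; this records where the blob branch now sits). [folklore] -/
theorem blobRiccatiClosure_of_noTypeII_of_typeIAncientLiouville (hII : IsobarTomography.NoTypeII)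
    (hL : ∀ (C : ℝ) (u : ℝ → EuclideanSpace ℝ (Fin 3) → EuclideanSpace ℝ (Fin 3)),
      ContDiffOn ℝ (⊤ : ℕ∞) (Function.uncurry u) (Set.Iio 0 ×ˢ Set.univ) ∧
      (∀ t < 0, Literature.Analysis.FluidPDE.VectorCalculus.IsDivFree (u t)) ∧
      (∀ s t : ℝ, s < t → t < 0 → ∀ x, u t x =
        Literature.Analysis.FluidPDE.heatFlow (u s) (t - s) x -
          ∫ τ in Set.Ioo s t, ∫ y,
            Literature.Analysis.FluidPDE.oseenKernel (t - τ) (x - y) (u τ y) (u τ y)) ∧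
      Literature.Analysis.FluidPDE.HasTypeITimeDecay C u → ∀ t < 0, ∀ x, u t x = 0) :
    IsobarTomography.BlobRiccatiClosure :=
  stub_cruxOfApexAntiBlob hII (apexAntiBlob_of_typeIAncientLiouville hL)

/-! ### The κ-free form of the residual C (for provers and refuters alike) -/

/-- `(∀ κ > 0, a < κ b) ↔ (0 ≤ b ∧ a ≤ 0 ∧ (b = 0 → a < 0))` for reals `a, b`. [folklore] -/
theorem forall_pos_lt_mul_iff {a b : ℝ} :
    (∀ κ : ℝ, 0 < κ → a < κ * b) ↔ (0 ≤ b ∧ a ≤ 0 ∧ (b = 0 → a < 0)) := by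
  constructor
  · intro h
    have hb : 0 ≤ b := by
      by_contra hb
      push Not at hb
      have hκ : 0 < (|a| + 1) / (-b) := div_pos (by positivity) (neg_pos.2 hb)
      have h1 := h _ hκ
      have h2 : (|a| + 1) / (-b) * b = -(|a| + 1) := by
        field_simp [hb.ne]
      rw [h2] at h1
      linarith [neg_abs_le a]
    refine ⟨hb, ?_, fun hb0 => by simpa [hb0] using h 1 one_pos⟩
    by_contra ha
    push Not at ha
    rcases hb.eq_or_lt with hb0 | hbpos
    · have := h 1 one_pos
      rw [← hb0, mul_zero] at this
      linarith
    · have hκ : 0 < a / (2 * b) := div_pos ha (by positivity)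
      have h1 := h _ hκ
      have h2 : a / (2 * b) * b = a / 2 := by
        field_simp
      rw [h2] at h1
      linarith
  · rintro ⟨hb, ha, h0⟩ κ hκ
    rcases hb.eq_or_lt with hb0 | hbpos
    · rw [← hb0, mul_zero]
      exact h0 hb0.symm
    · exact lt_of_le_of_lt ha (mul_pos hκ hbpos)

/-- **The κ-free form of the residual C: "Type-I apexes are vorticity-dominated-or-marginal and
axially pressure-non-convex".** The apex anti-blob statement (for all `κ > 0` at once) is
EQUIVALENT to: at every apex `(σ, 0)` of every Type-I ancient mild field with classical pressure
`q`, `0 ≤ Δq(σ)(0)`, `D²q(σ)(0)[ω, ω] ≤ 0`, and `D²q(σ)(0)[ω, ω] < 0` if `Δq(σ)(0) = 0`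
(`ω = curl W(σ)(0)`, `‖ω‖ = 1`; recall `Δq = ½‖ω‖² − |S|²`). A refuter kills C with ONE apex
violating one of the three signs; a prover may forget `κ`. [folklore] -/
theorem apexAntiBlob_iff_signs :
    (∀ κ : ℝ, 0 < κ → ∀ (C : ℝ) (W : ℝ → EuclideanSpace ℝ (Fin 3) → EuclideanSpace ℝ (Fin 3))
      (q : ℝ → EuclideanSpace ℝ (Fin 3) → ℝ) (σ : ℝ),
      IsTypeIAncientMild C W → IsClassicalNSSolutionOn (Iio 0) 1 0 W q → σ < 0 →
      ‖curl (W σ) 0‖ = 1 →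
      (∀ s < 0, ∀ y : EuclideanSpace ℝ (Fin 3), (-s) * ‖curl (W s) y‖ ≤ -σ) →
      iteratedFDeriv ℝ 2 (q σ) 0 ![curl (W σ) 0, curl (W σ) 0] <
        κ * ‖curl (W σ) 0‖ ^ 2 * Laplacian.laplacian (q σ) 0) ↔
    (∀ (C : ℝ) (W : ℝ → EuclideanSpace ℝ (Fin 3) → EuclideanSpace ℝ (Fin 3))
      (q : ℝ → EuclideanSpace ℝ (Fin 3) → ℝ) (σ : ℝ),
      IsTypeIAncientMild C W → IsClassicalNSSolutionOn (Iio 0) 1 0 W q → σ < 0 →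
      ‖curl (W σ) 0‖ = 1 →
      (∀ s < 0, ∀ y : EuclideanSpace ℝ (Fin 3), (-s) * ‖curl (W s) y‖ ≤ -σ) →
      0 ≤ Laplacian.laplacian (q σ) 0 ∧
      iteratedFDeriv ℝ 2 (q σ) 0 ![curl (W σ) 0, curl (W σ) 0] ≤ 0 ∧
      (Laplacian.laplacian (q σ) 0 = 0 →
        iteratedFDeriv ℝ 2 (q σ) 0 ![curl (W σ) 0, curl (W σ) 0] < 0)) := by
  constructor
  · intro h C W q σ hW hWq hσ hω1 hapex
    have h' : ∀ κ : ℝ, 0 < κ → iteratedFDeriv ℝ 2 (q σ) 0 ![curl (W σ) 0, curl (W σ) 0] <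
        κ * Laplacian.laplacian (q σ) 0 := fun κ hκ => by
      simpa [hω1] using h κ hκ C W q σ hW hWq hσ hω1 hapex
    exact forall_pos_lt_mul_iff.1 h'
  · intro h κ hκ C W q σ hW hWq hσ hω1 hapex
    have h' := forall_pos_lt_mul_iff.2 (h C W q σ hW hWq hσ hω1 hapex) κ hκ
    simpa [hω1] using h'

end Summit.NavierStokesRegularity.NavierStokesRegularity.Theorems.BlobRiccatiClosure.TypeIApexLiouville

end
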